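import Literature.Analysis.FluidPDE.SelfSimilarLiouville
import Literature.Analysis.FluidPDE.LeiRenZhang2019SlidingVelocity
import Literature.Analysis.FluidPDE.LeiRenZhang2019SlidingSwirl
import Literature.Analysis.FluidPDE.PeriodicLiouvilleFinal
import Literature.Analysis.FluidPDE.PeriodicOscillationStep
import HarnessLib

/-!
# Lei–Ren–Zhang 2019: the Liouville theorem for `z`-periodic bounded ancient axisymmetric
# solutions with bounded swirl (Theorem 1.1) and the sliding property (Lemma 5.1) — named facts
# and proved consequences

Analysis/FluidPDE statements file (two NAMED FACTS with cite tags, everything else proved) in the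
vocabulary of `Literature.Analysis.FluidPDE.SelfSimilarLiouville` (the duality-form class
`IsBoundedAncientMildSolution`, measurable axisymmetric slices `IsAxisymmetric`, the junk-free swirl
`swirl`, `cylRadius`, `eZ`), continuing the Lei–Ren–Zhang / Lei–Zhang–Zhao block of that file
(`leiRenZhang2019_liouville_swirl_rate` = Theorem 1.2, DISCHARGED in `LeiRenZhang2019Liouville`;
`leiRenZhang2019_swirl_sup_at_infinity` = §4, DISCHARGED; `leiZhangZhao2017_liouville_swirl_Lp` /
`…_decay`, DISCHARGED) with the two statements of the same paper that the tree did not carry: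

* `leiRenZhang2019_liouville_periodic` — **Theorem 1.1** (Z. Lei, X. Ren, Q. S. Zhang, *On ancient
  periodic solutions to axially-symmetric Navier–Stokes equations*, arXiv:1902.11229, p. 4;
  published as *A Liouville theorem for axi-symmetric Navier–Stokes equations on `ℝ² × 𝕋¹`*,
  Math. Ann. 383 (2022) 415–431; restated as Zhang–Pan, Anal. Theory Appl. 38 (2022), Thm 3.6):
  "Let `v = v_θ e_θ + v_r e_r + v_z e_z` be a bounded mild ancient solution to the ASNS such that
  `Γ = r v_θ` is bounded. Suppose `v` is periodic in the `z` variable. Then `v = c e_z` where `c` is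
  a constant." — the KNSS Liouville conjecture for axisymmetric bounded ancient solutions with
  bounded swirl ((AX-L), tree `AxisymmetricLiouvilleBoundedSwirl`, OPEN) **solved in the
  `z`-periodic class**, with no decay hypothesis on `v_r`, `v_z`.
* `leiRenZhang2019_sliding` — **Lemma 5.1 (Sliding Property)** (arXiv p. 13; "The conclusion is
  known in the literature. See the proof of Theorem 1.1 in [LZ]" = Lei–Zhang, J. Funct. Anal. 261
  (2011)): far from the axis a bounded ancient axisymmetric solution with bounded `Γ` flattens: along
  any sequence of base points `(x_n, t_n)` with `r(x_n) → ∞`, up to a subsequence `v` converges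
  uniformly to a constant vector, and `Γ` to a constant, on every parabolic cube `Q_R(x_n, t_n)`.

Proved here: (AX-L) and (L) contain Theorem 1.1 (`AxisymmetricLiouvilleBoundedSwirl.leiRenZhang2019_liouville_periodic`,
`LiouvilleConjectureNS.leiRenZhang2019_liouville_periodic`, hypotheses = the conjectures written
out, as for the sibling sanity implications of `SelfSimilarLiouville`); under Theorem 1.1 a
periodic field of the class has a.e. vanishing swirl on every slice
(`leiRenZhang2019_liouville_periodic.swirl_ae_eq_zero`) and, contrapositively, a field of the class
whose swirl is non-zero on a set of positive measure in one slice is not `z`-periodic with any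
period (`leiRenZhang2019_liouville_periodic.not_periodic_of_swirl_ne_zero` — the form in which a
candidate "inner limit" of an axisymmetric blow-up scenario consumes the theorem: such a limit must
carry swirl, `knss_axisymmetric_no_swirl_holds`, hence cannot be `z`-periodic); under Lemma 5.1 the
swirl of the class is, far from the axis, constant to any prescribed accuracy on parabolic cubes of
any prescribed size (`leiRenZhang2019_sliding.swirl_oscillation_le`, the projection used by
scenario bookkeeping).

## Rendering (read before citing)

* **Class.** As for every fact of the Lei–Zhang–Zhao / Lei–Ren–Zhang block of
  `SelfSimilarLiouville` (see the docstring of `AxisymmetricLiouvilleBoundedSwirl` there): print's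
  "bounded mild ancient solution" (KNSS 2009, §4 (i): `v ∈ L^∞(ℝ³ × (−∞, 0))`, smooth) is rendered
  by the tree's duality-form class `IsBoundedAncientMildSolution 1 u` with measurable *slices*,
  axisymmetry and the swirl bound imposed pointwise on every slice `t < 0`; the class bridge
  `exists_jointly_measurable_axial_modification` (`LeiRenZhang2019Liouville`) and KNSS's regularity
  (`KNSS2009_regularity_axisymmetric_swirl_holds`) identify such a `u`, slice by slice a.e. and up to
  an axial drift `e(t) e_z`, with a smooth bounded ancient solution of print's kind, to which the
  printed proofs apply verbatim (Theorem 1.1: the De Giorgi–Nash–Moser estimate of §§2–3 forces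
  `Γ ≡ 0`, then KNSS's Theorem 5.2 — tree `KNSS2009_liouville_axisymmetric_no_swirl_holds`, whose
  conclusion in the weak class is `b(t) e_z`). Accordingly the CONCLUSIONS are rendered slice-wise
  and insensitive to axial drifts: "`v = c e_z`" becomes "every slice `t < 0` is a.e. an axial
  constant `β e_z`" (`β` may depend on `t`; weaker than print, exactly as
  `leiRenZhang2019_liouville_swirl_rate` renders "`v = c e_z`").
* **Periodicity** is Mathlib's `Function.Periodic (u t) (P • eZ)` (`∀ x, u t (x + P e_z) = u t x`)
  with one period `P > 0` for all slices, imposed pointwise (print: "`v` is periodic in the `z`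
  variable"; §2 p. 5: "`L_θ` is periodic with period `Z₀`"; §3 normalises `Z₀ = 1`).
* **Lemma 5.1** is rendered in the subsequence-free, uniform OSCILLATION form, which for print's
  continuous solutions is equivalent to the printed sequential form by compactness of bounded sets
  of values (if the oscillation over `Q_R(x₀, t₀)` did not become small uniformly as `r(x₀) → ∞`, a
  violating sequence `(x_n, t_n)` would contradict the printed lemma; conversely small oscillation
  plus boundedness gives convergent subsequences of the values, with one constant for all `R`), and
  by axisymmetry the base points `x_n = (r_n, 0, z_n)` of print may be taken at any angle. In the
  slice-wise class the velocity statement is kept PER SLICE (a.e.-oscillation of `u(t)` over the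
  ball, uniformly for `t` in the time window — the axial drift forbids comparing two slices), while
  the swirl statement, drift-insensitive, is kept in print's space-time strength (a.e.-oscillation
  of `Γ` over the whole parabolic cube). Both are implied by, and for the continuous representative
  weaker than or equivalent to, the printed lemma.

## What is deliberately NOT here

No proof of Theorem 1.1 (§§2–3 of the source: a Moser iteration with a dimension-reduction effect
and a De Giorgi–Nash–Moser Hölder estimate for `Γ` exploiting
`v_r = −∂_z(L_θ(r,z) − L_θ(r,0)) ∈ (L^∞)^{−1}`; an L-sized formalisation) nor of Lemma 5.1
(translation compactness of the class + KNSS's planar Liouville theorem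
`KNSS2009_liouville_planar_holds` + the Liouville theorem for the heat equation with drift);
Lemma 5.2 of the source (`z`-periodic ⇒ `v_r → 0` uniformly as `r → ∞`) is not stated. Nothing here
concerns Euler, and nothing asserts or denies Navier–Stokes blow-up: these are Liouville-type
statements about ancient solutions.

## References

* Z. Lei, X. Ren, Q. S. Zhang, *On ancient periodic solutions to axially-symmetric Navier–Stokes
  equations*, arXiv:1902.11229 (2019): Theorem 1.1 (p. 4), Lemma 5.1 (p. 13); published split:
  Math. Ann. 383 (2022) 415–431, doi:10.1007/s00208-020-02128-9 (Thm 1.1) and Sci. Sin. Math. 51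
  (2021) 971–984 (Thm 1.2). [LeiRenZhang2019]
* Q. S. Zhang, X. Pan, *A review of results on axially symmetric Navier–Stokes equations*, Anal.
  Theory Appl. 38 (2022) = arXiv:2101.04905, Theorem 3.6 (restatement of Thm 1.1) and §3.
  [ZhangPan2022]
* G. Koch, N. Nadirashvili, G. Seregin, V. Šverák, Acta Math. 203 (2009) = arXiv:0709.3599, §1
  (the conjecture), Thms 5.1–5.2. [KochNadirashviliSereginSverak2009]
* Z. Lei, Q. S. Zhang, J. Funct. Anal. 261 (2011) 2323–2345, proof of Thm 1.1 (the sliding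
  argument). [LeiZhang2011]
-/

noncomputable section

open MeasureTheory Set Function Filter Topology TopologicalSpace
open scoped NNReal ENNReal RealInnerProductSpace

namespace Literature.Analysis.FluidPDE

/-- Local notation for physical space `ℝ³ = EuclideanSpace ℝ (Fin 3)`. -/
local notation "ℝ³" => EuclideanSpace ℝ (Fin 3)

/-! ### The two named facts -/

/-- **Lei–Ren–Zhang 2019, Theorem 1.1** (Z. Lei, X. Ren, Q. S. Zhang, *On ancient periodic
solutions to axially-symmetric Navier–Stokes equations*, arXiv:1902.11229, Theorem 1.1, p. 4 —
published as *A Liouville theorem for axi-symmetric Navier–Stokes equations on `ℝ² × 𝕋¹`*, Math.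
Ann. 383 (2022) 415–431; restated as Zhang–Pan, Anal. Theory Appl. 38 (2022), Theorem 3.6: "Let
`v = v_θ e_θ + v_r e_r + v_z e_z` be a bounded mild ancient solution to the ASNS such that
`Γ = r v_θ` is bounded. Suppose `v` is periodic in the `z` variable. Then `v = c e_z` where `c` is a
constant."; p. 3: "We emphasize that no decay condition is imposed on the velocity"; proof §§2–3: a De Giorgi–Nash–Moser
Hölder estimate, made possible by periodicity through `v_r = −∂_z(L_θ(r,z) − L_θ(r,0)) ∈ (L^∞)^{−1}`,
forces `Γ ≡ 0`, and the swirl-free case is KNSS's Theorem 5.2.) **Statement.** Every bounded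
ancient mild solution `u` of Navier–Stokes (`ν = 1`) on `ℝ³ × (−∞, 0)` with measurable axisymmetric
slices and bounded swirl `Γ = swirl (u t)`, all of whose slices `t < 0` are periodic in the axial
direction with one period `P > 0` (`u t (x + P e_z) = u t x` for all `x`), is on every slice `t < 0`
a.e. equal to an axial constant `β e_z`. **Rendering** (module docstring): the duality-form class
with slice-wise pointwise hypotheses stands for print's bounded mild (smooth) solutions, and print's
"`v = c e_z`" is rendered slice-wise (`β` may depend on `t`), exactly as in
`leiRenZhang2019_liouville_swirl_rate`; weaker than print in the conclusion. A PROVED theorem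
in print (the `z`-periodic sub-case of (AX-L); sanity implication
`AxisymmetricLiouvilleBoundedSwirl.leiRenZhang2019_liouville_periodic` below). [cite: LeiRenZhang2019, Thm 1.1 (arXiv p. 4) and §§2–3; ZhangPan2022, Thm 3.6] -/
def leiRenZhang2019_liouville_periodic : Prop :=
  ∀ u : ℝ → ℝ³ → ℝ³, FluidPDE.IsBoundedAncientMildSolution 1 u →
    (∀ t < 0, AEStronglyMeasurable (u t) volume) →
      (∀ t < 0, FluidPDE.IsAxisymmetric (u t)) →
        (∃ C : ℝ, ∀ t < 0, ∀ x, |FluidPDE.swirl (u t) x| ≤ C) →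
          (∃ P : ℝ, 0 < P ∧ ∀ t < 0, Function.Periodic (u t) (P • FluidPDE.eZ)) →
            ∀ t < 0, ∃ β : ℝ, u t =ᵐ[volume] fun _ => β • FluidPDE.eZ

/-- **Lei–Ren–Zhang 2019, Lemma 5.1 (Sliding Property)** (arXiv:1902.11229, §5, p. 13: "Let `v`
be a bounded ancient mild solution to ASNS with `|Γ| ≲ 1`. Let `(x_n, t_n)` be any sequence with
`x_n = (r_n, 0, z_n)` such that `r_n → ∞`. Then, up to a subsequence, `v` uniformly converges to a
constant vector on the parabolic cube `Q_R(x_n, t_n) = {(x, t) | |x − x_n| < R, 0 < t_n − t < R²}`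
for any given `R > 0`. Moreover, up to a further subsequence, `Γ` uniformly converges to a constant
on `Q_R(x_n, t_n)`." — "The conclusion is known in the literature. See the proof of Theorem 1.1 in
[LZ]" (Lei–Zhang, J. Funct. Anal. 261 (2011)); proof there: the translates
`v⁽ⁿ⁾(x,t) = v(x_n + x, t_n + t)` converge in `C^{2k,k}_loc` to a bounded ancient mild solution
invariant in one horizontal direction, whose in-plane part is a planar bounded ancient solution,
constant by KNSS's Theorem 5.1 (tree `KNSS2009_liouville_planar_holds`), and `Γ⁽ⁿ⁾ → Γ⁽∞⁾`, a
bounded ancient solution of a heat equation with constant drift, constant by the Liouville theorem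
for the heat equation.) **Statement (uniform oscillation form).** Let `u` be a bounded ancient mild
solution of Navier–Stokes (`ν = 1`) on `ℝ³ × (−∞, 0)` with measurable axisymmetric slices and bounded
swirl `Γ`. Then for every cube size `R > 0` and accuracy `ε > 0` there is a radius `ρ` such that for
every base point `(x₀, t₀)` with `t₀ ≤ 0` and `r(x₀) ≥ ρ`: (i) every slice `u(t)`,
`t ∈ (t₀ − R², t₀)`, has a.e.-oscillation at most `ε` over the ball `B(x₀, R)` (for a.e. pair
`x, y` of points of the ball, `‖u(t,x) − u(t,y)‖ ≤ ε`), and (ii) the swirl has a.e.-oscillation at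
most `ε` over the whole parabolic cube `Q_R(x₀, t₀)` (for all `t, t' ∈ (t₀ − R², t₀)` and a.e. pair
`x, y` in the ball, `|Γ(t,x) − Γ(t',y)| ≤ ε`). **Rendering** (module docstring): for print's
continuous solutions the oscillation form is equivalent to the printed sequential form (compactness
of bounded sets of values; base points at any angle by axisymmetry); in the slice-wise class the
velocity statement is kept per slice (an axial drift `e(t) e_z` invisible to the class forbids
comparing slices) and the drift-insensitive swirl statement keeps print's space-time strength; both
are consequences of the printed lemma. [cite: LeiRenZhang2019, Lemma 5.1 (arXiv p. 13); LeiZhang2011, proof of Thm 1.1] -/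
def leiRenZhang2019_sliding : Prop :=
  ∀ u : ℝ → ℝ³ → ℝ³, FluidPDE.IsBoundedAncientMildSolution 1 u →
    (∀ t < 0, AEStronglyMeasurable (u t) volume) →
      (∀ t < 0, FluidPDE.IsAxisymmetric (u t)) →
        (∃ C : ℝ, ∀ t < 0, ∀ x, |FluidPDE.swirl (u t) x| ≤ C) →
          ∀ R : ℝ, 0 < R → ∀ ε : ℝ, 0 < ε → ∃ ρ : ℝ, ∀ t₀ : ℝ, t₀ ≤ 0 → ∀ x₀ : ℝ³,
            ρ ≤ FluidPDE.cylRadius x₀ →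
              (∀ t ∈ Ioo (t₀ - R ^ 2) t₀,
                  ∀ᵐ x ∂(volume : Measure ℝ³), ∀ᵐ y ∂(volume : Measure ℝ³),
                    x ∈ Metric.ball x₀ R → y ∈ Metric.ball x₀ R → ‖u t x - u t y‖ ≤ ε) ∧
              (∀ t ∈ Ioo (t₀ - R ^ 2) t₀, ∀ t' ∈ Ioo (t₀ - R ^ 2) t₀,
                  ∀ᵐ x ∂(volume : Measure ℝ³), ∀ᵐ y ∂(volume : Measure ℝ³),
                    x ∈ Metric.ball x₀ R → y ∈ Metric.ball x₀ R →
                      |FluidPDE.swirl (u t) x - FluidPDE.swirl (u t') y| ≤ ε)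

/-! ### Theorem 1.1 inside the open problems (AX-L) and (L) -/

/-- (AX-L) contains Lei–Ren–Zhang's Theorem 1.1, which is a sub-case of the open problem (the
`z`-periodic case; Lei–Ren–Zhang 2019, p. 3: "In this case the conjecture is fully solved"): under
`AxisymmetricLiouvilleBoundedSwirl` the slices are a.e. constant, and a constant slice with bounded
swirl is axial (`eq_smul_eZ_of_ae_eq_const_of_abs_swirl_le`); the periodicity hypothesis is not
used. **Hypothesis.** `h` is the statement (AX-L) written out — letter for letter the definiens of
the canonical `Summit.NavierStokesRegularity.NavierStokesRegularity.AxisymmetricLiouvilleBoundedSwirl`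
(and of the transitional copy `AxisymmetricLiouvilleBoundedSwirl` of `SelfSimilarLiouville`) —, so
the theorem mentions neither `Prop` and applies verbatim (by unfolding) to a witness of the
canonical conjecture (same design as `AxisymmetricLiouvilleBoundedSwirl.leiRenZhang2019_liouville_swirl_rate`). [cite: LeiRenZhang2019, §1 pp. 3–4] -/
theorem AxisymmetricLiouvilleBoundedSwirl.leiRenZhang2019_liouville_periodic
    (h : ∀ u : ℝ → ℝ³ → ℝ³, FluidPDE.IsBoundedAncientMildSolution 1 u →
      (∀ t < 0, AEStronglyMeasurable (u t) volume) →
        (∀ t < 0, FluidPDE.IsAxisymmetric (u t)) →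
          (∃ C : ℝ, ∀ t < 0, ∀ x, |FluidPDE.swirl (u t) x| ≤ C) →
            ∀ t < 0, ∃ b : ℝ³, u t =ᵐ[volume] fun _ => b) :
    leiRenZhang2019_liouville_periodic := by
  intro u hu hmeas haxi hswirl _ t ht
  obtain ⟨C, hC⟩ := hswirl
  obtain ⟨b, hb⟩ := h u hu hmeas haxi ⟨C, hC⟩ t ht
  have e : b = b 2 • FluidPDE.eZ := eq_smul_eZ_of_ae_eq_const_of_abs_swirl_le hb (hC t ht)
  refine ⟨b 2, ?_⟩
  rw [← e]
  exact hb

/-- The Liouville conjecture (L) contains Lei–Ren–Zhang's Theorem 1.1 (through (AX-L), of which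
(L) is a strengthening: forget the symmetry, swirl and periodicity hypotheses). **Hypothesis.** `hL`
is the statement (L) written out — letter for letter the definiens of the canonical
`Summit.NavierStokesRegularity.NavierStokesRegularity.LiouvilleConjectureNS` (and of the
transitional copy `LiouvilleConjectureNS` of `SelfSimilarLiouville`) —, as for
`LiouvilleConjectureNS.leiRenZhang2019_liouville_swirl_rate`. [cite: LeiRenZhang2019, §1 p. 3 (the conjecture of [KNSS])] -/
theorem LiouvilleConjectureNS.leiRenZhang2019_liouville_periodic
    (hL : ∀ u : ℝ → ℝ³ → ℝ³, FluidPDE.IsBoundedAncientMildSolution 1 u →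
      (∀ t < 0, AEStronglyMeasurable (u t) volume) →
        ∀ t < 0, ∃ b : ℝ³, u t =ᵐ[volume] fun _ => b) :
    leiRenZhang2019_liouville_periodic :=
  AxisymmetricLiouvilleBoundedSwirl.leiRenZhang2019_liouville_periodic
    fun u hu hmeas _ _ => hL u hu hmeas

/-! ### Consequences of Theorem 1.1: periodic fields of the class are swirl-free -/

/-- Under Lei–Ren–Zhang's Theorem 1.1: a `z`-periodic bounded ancient mild solution with measurable
axisymmetric slices and bounded swirl has **a.e. vanishing swirl on every slice** `t < 0` (each
slice is a.e. the axial constant `β e_z`, whose swirl is `0`). In print this is the heart of the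
theorem ("a partially scaling invariant Hölder estimate which forces `Γ ≡ 0`", p. 4). [cite: LeiRenZhang2019, Thm 1.1 and p. 4] -/
theorem leiRenZhang2019_liouville_periodic.swirl_ae_eq_zero
    (h : leiRenZhang2019_liouville_periodic) {u : ℝ → ℝ³ → ℝ³}
    (hu : FluidPDE.IsBoundedAncientMildSolution 1 u)
    (hmeas : ∀ t < 0, AEStronglyMeasurable (u t) volume)
    (haxi : ∀ t < 0, FluidPDE.IsAxisymmetric (u t))
    (hswirl : ∃ C : ℝ, ∀ t < 0, ∀ x, |FluidPDE.swirl (u t) x| ≤ C)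
    (hper : ∃ P : ℝ, 0 < P ∧ ∀ t < 0, Function.Periodic (u t) (P • FluidPDE.eZ))
    {t : ℝ} (ht : t < 0) :
    ∀ᵐ x ∂(volume : Measure ℝ³), FluidPDE.swirl (u t) x = 0 := by
  obtain ⟨β, hb⟩ := h u hu hmeas haxi hswirl hper t ht
  filter_upwards [hb] with x hx
  have hb0 : (β • FluidPDE.eZ : ℝ³) 0 = 0 := by simp [FluidPDE.eZ]
  have hb1 : (β • FluidPDE.eZ : ℝ³) 1 = 0 := by simp [FluidPDE.eZ]
  rw [FluidPDE.swirl, hx, hb0, hb1, mul_zero, mul_zero, sub_zero]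

/-- Under Lei–Ren–Zhang's Theorem 1.1, **kill form**: a bounded ancient mild solution with
measurable axisymmetric slices and bounded swirl whose swirl is non-zero on a set of positive
measure in some slice `t₀ < 0` is **not periodic in `z`** (with any period common to all slices).
This is the form consumed by blow-up bookkeeping: a non-constant bounded ancient axisymmetric limit
of a putative singularity must carry swirl (KNSS's Theorem 5.2, tree
`knss_axisymmetric_no_swirl_holds`), hence — under this theorem — cannot be `z`-periodic
(Lei–Ren–Zhang 2019, p. 3: "periodic solutions are not models of high velocity region for ASNS"). [cite: LeiRenZhang2019, Thm 1.1 and p. 3] -/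
theorem leiRenZhang2019_liouville_periodic.not_periodic_of_swirl_ne_zero
    (h : leiRenZhang2019_liouville_periodic) {u : ℝ → ℝ³ → ℝ³}
    (hu : FluidPDE.IsBoundedAncientMildSolution 1 u)
    (hmeas : ∀ t < 0, AEStronglyMeasurable (u t) volume)
    (haxi : ∀ t < 0, FluidPDE.IsAxisymmetric (u t))
    (hswirl : ∃ C : ℝ, ∀ t < 0, ∀ x, |FluidPDE.swirl (u t) x| ≤ C)
    {t₀ : ℝ} (ht₀ : t₀ < 0) (hpos : 0 < volume {x : ℝ³ | FluidPDE.swirl (u t₀) x ≠ 0}) :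
    ¬ ∃ P : ℝ, 0 < P ∧ ∀ t < 0, Function.Periodic (u t) (P • FluidPDE.eZ) := by
  intro hper
  have hae := h.swirl_ae_eq_zero hu hmeas haxi hswirl hper ht₀
  have hnull : volume {x : ℝ³ | ¬ FluidPDE.swirl (u t₀) x = 0} = 0 := ae_iff.1 hae
  exact hpos.ne' hnull

/-- Under Lei–Ren–Zhang's Theorem 1.1, the same kill form phrased with the essential supremum: if
the swirl of some slice `t₀ < 0` has positive `L^∞` norm, the field is not `z`-periodic. [cite: LeiRenZhang2019, Thm 1.1] -/
theorem leiRenZhang2019_liouville_periodic.not_periodic_of_eLpNorm_swirl_pos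
    (h : leiRenZhang2019_liouville_periodic) {u : ℝ → ℝ³ → ℝ³}
    (hu : FluidPDE.IsBoundedAncientMildSolution 1 u)
    (hmeas : ∀ t < 0, AEStronglyMeasurable (u t) volume)
    (haxi : ∀ t < 0, FluidPDE.IsAxisymmetric (u t))
    (hswirl : ∃ C : ℝ, ∀ t < 0, ∀ x, |FluidPDE.swirl (u t) x| ≤ C)
    {t₀ : ℝ} (ht₀ : t₀ < 0) (hpos : 0 < eLpNorm (FluidPDE.swirl (u t₀)) ∞ (volume : Measure ℝ³)) :
    ¬ ∃ P : ℝ, 0 < P ∧ ∀ t < 0, Function.Periodic (u t) (P • FluidPDE.eZ) := by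
  intro hper
  have hae := h.swirl_ae_eq_zero hu hmeas haxi hswirl hper ht₀
  have h0 : eLpNorm (FluidPDE.swirl (u t₀)) ∞ (volume : Measure ℝ³) = 0 := by
    rw [eLpNorm_congr_ae (show FluidPDE.swirl (u t₀) =ᵐ[volume] (0 : ℝ³ → ℝ) from hae),
      eLpNorm_zero]
  exact hpos.ne' h0

/-! ### A consequence of Lemma 5.1: the far-field swirl is locally constant -/

/-- Under Lei–Ren–Zhang's Lemma 5.1, the projection used by scenario bookkeeping: for a bounded
ancient mild solution with measurable axisymmetric slices and bounded swirl, for every cube size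
`R > 0` and accuracy `ε > 0` there is a radius beyond which, on every parabolic cube `Q_R(x₀, t₀)`
(`t₀ ≤ 0`), the swirl is a.e. `ε`-close across any two of its slices and any two of its points — in
particular a swirl profile with a far-field oscillation bounded below on cubes of fixed size is
excluded. [cite: LeiRenZhang2019, Lemma 5.1 (arXiv p. 13)] -/
theorem leiRenZhang2019_sliding.swirl_oscillation_le
    (h : leiRenZhang2019_sliding) {u : ℝ → ℝ³ → ℝ³}
    (hu : FluidPDE.IsBoundedAncientMildSolution 1 u)
    (hmeas : ∀ t < 0, AEStronglyMeasurable (u t) volume)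
    (haxi : ∀ t < 0, FluidPDE.IsAxisymmetric (u t))
    (hswirl : ∃ C : ℝ, ∀ t < 0, ∀ x, |FluidPDE.swirl (u t) x| ≤ C)
    {R ε : ℝ} (hR : 0 < R) (hε : 0 < ε) :
    ∃ ρ : ℝ, ∀ t₀ : ℝ, t₀ ≤ 0 → ∀ x₀ : ℝ³, ρ ≤ FluidPDE.cylRadius x₀ →
      ∀ t ∈ Ioo (t₀ - R ^ 2) t₀, ∀ t' ∈ Ioo (t₀ - R ^ 2) t₀,
        ∀ᵐ x ∂(volume : Measure ℝ³), ∀ᵐ y ∂(volume : Measure ℝ³),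
          x ∈ Metric.ball x₀ R → y ∈ Metric.ball x₀ R →
            |FluidPDE.swirl (u t) x - FluidPDE.swirl (u t') y| ≤ ε := by
  obtain ⟨ρ, hρ⟩ := h u hu hmeas haxi hswirl R hR ε hε
  exact ⟨ρ, fun t₀ ht₀ x₀ hx₀ => (hρ t₀ ht₀ x₀ hx₀).2⟩

/-- **Lei–Ren–Zhang 2019, Lemma 5.1 (Sliding Property), PROVED**: the named fact
`leiRenZhang2019_sliding` holds — conjunct (i) is `leiRenZhang2019_sliding_velocity_cubes`
(`LeiRenZhang2019SlidingVelocity`: class bridge, KNSS §4 representative, every slice of `u` is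
`U(t)` plus an axial constant, and the far-field flattening of `U` by the receding-axes
compactness argument and KNSS's planar Liouville theorem), conjunct (ii) is
`leiRenZhang2019_sliding_swirl_cubes` (`LeiRenZhang2019SlidingSwirl`: Galilean frame with the
parasitic drift, parabolic rescaling, and oscillation decay for the swirl equation from the
interior Harnack inequality with bounded drift, `Lieberman1996_harnack_drift_gap_holds`); the two
radii are combined by `max`. [cite: LeiRenZhang2019, Lemma 5.1 (arXiv:1902.11229 p. 13)] -/
theorem leiRenZhang2019_sliding_holds : leiRenZhang2019_sliding := by
  intro u hu hm hax hsw R hR ε hε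
  obtain ⟨ρ₁, h₁⟩ := leiRenZhang2019_sliding_velocity_cubes u hu hm hax hsw R hR ε hε
  obtain ⟨ρ₂, h₂⟩ := leiRenZhang2019_sliding_swirl_cubes u hu hm hax hsw R hR ε hε
  exact ⟨max ρ₁ ρ₂, fun t₀ ht₀ x₀ hx₀ =>
    ⟨fun t ht => h₁ t₀ ht₀ x₀ ((le_max_left _ _).trans hx₀) t ht,
     fun t ht t' ht' => h₂ t₀ ht₀ x₀ ((le_max_right _ _).trans hx₀) t ht t' ht'⟩⟩

/-- **Lei–Ren–Zhang 2019, Theorem 1.1, PROVED**: the named fact `leiRenZhang2019_liouville_periodic`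
holds — `LeiRenZhang2019.liouville_periodic_of_oscillation_step` (`PeriodicLiouvilleFinal`: the
class bridge and KNSS §4 regularity giving the periodic swirl data, the oscillation iteration
`periodic_swirl_setting_eq_zero` forcing `Γ ≡ 0`, and KNSS's Theorem 5.2 in the periodic bounded
weak class) fed with the one-step oscillation decay `LeiRenZhang2019.oscillation_step_periodic`
(`PeriodicOscillationStep`: the mean value inequality per period = Lemma 2.1, the lower mass bound
= Lemma 3.3, the logarithmic estimate = Lemma 3.1, and the sublevel/Chebyshev step of the proof of
Theorem 1.1, p. 9). [cite: LeiRenZhang2019, Thm 1.1 (arXiv:1902.11229 p. 4; proof pp. 5–9)] -/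
theorem leiRenZhang2019_liouville_periodic_holds : leiRenZhang2019_liouville_periodic :=
  fun u hu hmeas haxi hswirl hper =>
    LeiRenZhang2019.liouville_periodic_of_oscillation_step LeiRenZhang2019.oscillation_step_periodic u hu
      hmeas haxi hswirl hper

end Literature.Analysis.FluidPDE
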